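/-
Copyright: harness cell b2b-lgcu-borel (gen 13).  Honest framing: the VALUE here is a THEOREM (an
all-`p`, all-`ε ≤ 1` no-go for ONE configuration class of the `(m,k) = (2,1)` cell) — NOT summit
progress; the crux item `SubgroupIdentityDesigns` (stmt-MatrixMultiplication-14079) stays open.
-/
import Summits.MatrixMultiplication.MatrixMultiplication.Theorems.SubgroupIdentityDesigns.Negative.DecoratedSylowLaw
import Summits.MatrixMultiplication.MatrixMultiplication.Theorems.SubgroupIdentityDesigns.Negative.LevelOneExact

/-!
# No decorated-Sylow witness of the crux in `GL₂(𝔽_p)`, any prime `p`, any `0 ≤ ε ≤ 1`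

Combining the decorated-Sylow packing law `|H₁||H₂||H₃| ≤ p³(p-1)`
(`DecoratedSylowLaw.decoratedSylow_volume_le`: subgroup-TPP triples with
`U_{xᵢ} ≤ Hᵢ ≤ B_{xᵢ}` at the three points `[e₀], [e₀+e₁], [e₁]` of `ℙ¹(𝔽_p)`) with the exact
level-one floor `1 + p^s + (p-2)(p+1)^s ≤ budget p 2 1 s` (`LevelOneExact.budget_ge_exact` at
`l = 1`) gives, for `s = 2 + ε ∈ [2, 3]`,
`V^{s/3} ≤ (p³(p-1))^{s/3} ≤ 1 + p^s + (p-2)(p+1)^s ≤ budget`,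
so NO such triple satisfies the crux inequality `budget < V^{(2+ε)/3}` at level one — for every
prime `p` and every `0 ≤ ε ≤ 1`, with or without an identity design (`no_decoratedSylow_witness`).
The elementary inequality (`rpow_volume_le_floor`) is proved by cases `p = 2`, `p = 3`, `p ≥ 4`.

Scope, honestly: this is the `n_p = 3` class (all three subgroups of order divisible by `p`, none
containing `SL₂`) of the `(m,k) = (2,1)` cell only; the classes with `p'`-members, the levels
`k ≥ 2` and `m ≥ 3` are untouched.  Report:
`run/shared/lean/b2b/levelgraded-cu/ORACLE-g13.md` §G13-3.  Sorry-free; no new definitions.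
-/

set_option linter.dupNamespace false

noncomputable section

open scoped BigOperators Classical
open Summit.MatrixMultiplication.MatrixMultiplication.Theorems.LieRankDesigns.Negative (GLm Mat budget)

namespace Summit.MatrixMultiplication.MatrixMultiplication.Theorems.SubgroupIdentityDesigns.Negative

section DecoratedSylowNoGo

open Literature.Barriers.MatrixMultiplication (SubgroupTPP)

variable {p : ℕ} [hp : Fact p.Prime]

/-- The exact level-one floor in `GL₂(𝔽_p)`: `1 + p^s + (p-2)(p+1)^s ≤ budget p 2 1 s`
(`LevelOneExact.budget_ge_exact` at `l = 1`, with `(p²-p)/(p-1) = p`, `(p²-1)/(p-1) = p+1`). -/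
theorem budget_two_ge (s : ℝ) :
    1 + (p : ℝ) ^ s + ((p : ℝ) - 2) * ((p : ℝ) + 1) ^ s ≤ budget p 2 1 s := by
  have h := LevelOneExact.budget_ge_exact (p := p) (l := 1) le_rfl s
  have hpR : (2 : ℝ) ≤ p := by exact_mod_cast hp.out.two_le
  have hp1 : (p : ℝ) - 1 ≠ 0 := by
    intro h0
    linarith
  have e1 : ((p : ℝ) ^ (1 + 1) - p) / ((p : ℝ) - 1) = p := by
    rw [div_eq_iff hp1]
    ring
  have e2 : ((p : ℝ) ^ (1 + 1) - 1) / ((p : ℝ) - 1) = p + 1 := by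
    rw [div_eq_iff hp1]
    ring
  rw [e1, e2] at h
  exact h

/-- The elementary inequality: `V ≤ p³(p-1)` and `2 ≤ s ≤ 3` give
`V^{s/3} ≤ 1 + p^s + (p-2)(p+1)^s` (cases `p = 2`, `p = 3`, `p ≥ 4`). -/
theorem rpow_volume_le_floor {V : ℕ} (hV : V ≤ p ^ 3 * (p - 1)) {s : ℝ} (hs2 : 2 ≤ s)
    (hs3 : s ≤ 3) :
    (V : ℝ) ^ (s / 3) ≤ 1 + (p : ℝ) ^ s + ((p : ℝ) - 2) * ((p : ℝ) + 1) ^ s := by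
  have hp2 : 2 ≤ p := hp.out.two_le
  have hpR : (2 : ℝ) ≤ p := by exact_mod_cast hp2
  have hp1 : 1 ≤ p := by omega
  have hVR : (V : ℝ) ≤ (p : ℝ) ^ 3 * ((p : ℝ) - 1) := by
    have hc : ((p ^ 3 * (p - 1) : ℕ) : ℝ) = (p : ℝ) ^ 3 * ((p : ℝ) - 1) := by
      push_cast [Nat.cast_sub hp1]
      ring
    rw [← hc]
    exact_mod_cast hV
  have hV0 : (0 : ℝ) ≤ V := Nat.cast_nonneg _
  have hs0 : 0 ≤ s / 3 := by linarith
  have h3s : ((3 : ℕ) : ℝ) * (s / 3) = s := by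
    push_cast
    ring
  -- step 1: `V^{s/3} ≤ p^s (p-1)^{s/3}`
  have step1 : (V : ℝ) ^ (s / 3) ≤ (p : ℝ) ^ s * ((p : ℝ) - 1) ^ (s / 3) := by
    calc (V : ℝ) ^ (s / 3) ≤ ((p : ℝ) ^ 3 * ((p : ℝ) - 1)) ^ (s / 3) :=
          Real.rpow_le_rpow hV0 hVR hs0
      _ = ((p : ℝ) ^ 3) ^ (s / 3) * ((p : ℝ) - 1) ^ (s / 3) :=
          Real.mul_rpow (by positivity) (by linarith)
      _ = (p : ℝ) ^ s * ((p : ℝ) - 1) ^ (s / 3) := by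
          congr 1
          rw [← Real.rpow_natCast, ← Real.rpow_mul (by linarith), h3s]
  have hps0 : 0 ≤ (p : ℝ) ^ s := by positivity
  rcases (show p = 2 ∨ p = 3 ∨ 4 ≤ p by omega) with rfl | rfl | hp4
  · -- `p = 2`: `V^{s/3} ≤ 2^s`
    have e : (((2 : ℕ) : ℝ) - 1) ^ (s / 3) = 1 := by
      rw [show ((2 : ℕ) : ℝ) - 1 = 1 by norm_num, Real.one_rpow]
    rw [e, mul_one] at step1
    have hq : 0 ≤ (((2 : ℕ) : ℝ) - 2) * (((2 : ℕ) : ℝ) + 1) ^ s := by norm_num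
    linarith
  · -- `p = 3`: `V^{s/3} ≤ 3^s · 2^{s/3} ≤ 2 · 3^s ≤ 3^s + 4^s`
    norm_num at step1 hps0 ⊢
    have h2 : (2 : ℝ) ^ (s / 3) ≤ 2 := by
      calc (2 : ℝ) ^ (s / 3) ≤ (2 : ℝ) ^ (1 : ℝ) :=
            Real.rpow_le_rpow_of_exponent_le (by norm_num) (by linarith)
        _ = 2 := Real.rpow_one _
    have h34 : (3 : ℝ) ^ s ≤ (4 : ℝ) ^ s :=
      Real.rpow_le_rpow (by norm_num) (by norm_num) (by linarith)
    have h3 : 0 ≤ (3 : ℝ) ^ s := by positivity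
    have hm := mul_le_mul_of_nonneg_left h2 h3
    linarith
  · -- `p ≥ 4`: `V^{s/3} ≤ p^s (p-1) = p^{s-2} · p²(p-1) ≤ (p+1)^{s-2} · (p-2)(p+1)² = (p-2)(p+1)^s`
    have hp4R : (4 : ℝ) ≤ p := by exact_mod_cast hp4
    have hA : ((p : ℝ) - 1) ^ (s / 3) ≤ (p : ℝ) - 1 := by
      calc ((p : ℝ) - 1) ^ (s / 3) ≤ ((p : ℝ) - 1) ^ (1 : ℝ) :=
            Real.rpow_le_rpow_of_exponent_le (by linarith) (by linarith)
        _ = (p : ℝ) - 1 := Real.rpow_one _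
    have hps : (p : ℝ) ^ s = (p : ℝ) ^ (s - 2) * (p : ℝ) ^ 2 := by
      rw [← Real.rpow_two, ← Real.rpow_add (by linarith : (0 : ℝ) < p)]
      congr 1
      ring
    have hqs : ((p : ℝ) + 1) ^ s = ((p : ℝ) + 1) ^ (s - 2) * ((p : ℝ) + 1) ^ 2 := by
      rw [← Real.rpow_two, ← Real.rpow_add (by linarith : (0 : ℝ) < (p : ℝ) + 1)]
      congr 1
      ring
    have hmono : (p : ℝ) ^ (s - 2) ≤ ((p : ℝ) + 1) ^ (s - 2) :=
      Real.rpow_le_rpow (by linarith) (by linarith) (by linarith)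
    have hpoly : ((p : ℝ) - 1) * (p : ℝ) ^ 2 ≤ ((p : ℝ) - 2) * ((p : ℝ) + 1) ^ 2 := by
      nlinarith [mul_nonneg (sub_nonneg.2 hp4R) (by linarith : (0 : ℝ) ≤ (p : ℝ) + 1)]
    have hpow0 : 0 ≤ ((p : ℝ) + 1) ^ (s - 2) := by positivity
    have hc0 : 0 ≤ ((p : ℝ) - 1) * (p : ℝ) ^ 2 := by
      have : (0 : ℝ) ≤ (p : ℝ) - 1 := by linarith
      positivity
    calc (V : ℝ) ^ (s / 3) ≤ (p : ℝ) ^ s * ((p : ℝ) - 1) ^ (s / 3) := step1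
      _ ≤ (p : ℝ) ^ s * ((p : ℝ) - 1) := mul_le_mul_of_nonneg_left hA hps0
      _ = (p : ℝ) ^ (s - 2) * (((p : ℝ) - 1) * (p : ℝ) ^ 2) := by
          rw [hps]
          ring
      _ ≤ ((p : ℝ) + 1) ^ (s - 2) * (((p : ℝ) - 2) * ((p : ℝ) + 1) ^ 2) :=
          mul_le_mul hmono hpoly hc0 hpow0
      _ = ((p : ℝ) - 2) * ((p : ℝ) + 1) ^ s := by
          rw [hqs]
          ring
      _ ≤ 1 + (p : ℝ) ^ s + ((p : ℝ) - 2) * ((p : ℝ) + 1) ^ s := by linarith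

/-- **NO DECORATED-SYLOW WITNESS, ANY PRIME, ANY `0 ≤ ε ≤ 1`.**  If `U_{[e₀]} ≤ H₁ ≤ B_{[e₀]}`,
`U_{[e₀+e₁]} ≤ H₂ ≤ B_{[e₀+e₁]}`, `U_{[e₁]} ≤ H₃ ≤ B_{[e₁]}` (entry-wise hypotheses as in
`decoratedSylow_volume_le`) and `(H₁, H₂, H₃)` has the subgroup TPP, then the crux inequality
`budget p 2 1 (2+ε) < (|H₁||H₂||H₃|)^{(2+ε)/3}` FAILS at level one — no identity design needed. -/
theorem no_decoratedSylow_witness {ε : ℝ} (hε0 : 0 ≤ ε) (hε1 : ε ≤ 1)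
    {H₁ H₂ H₃ : Subgroup (GLm p 2)}
    (hB₁ : ∀ h ∈ H₁, (h : Mat p 2) 1 0 = 0)
    (hU₁ : ∀ u : GLm p 2, (u : Mat p 2) 1 0 = 0 → (u : Mat p 2) 0 0 = 1 → (u : Mat p 2) 1 1 = 1 →
      u ∈ H₁)
    (hB₂ : ∀ h ∈ H₂, (h : Mat p 2) 0 0 + (h : Mat p 2) 0 1 = (h : Mat p 2) 1 0 + (h : Mat p 2) 1 1)
    (hU₂ : ∀ u : GLm p 2,
      (u : Mat p 2) 0 0 + (u : Mat p 2) 0 1 = (u : Mat p 2) 1 0 + (u : Mat p 2) 1 1 →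
      (u : Mat p 2) 0 0 + (u : Mat p 2) 0 1 = 1 → (u : Mat p 2) 1 1 - (u : Mat p 2) 0 1 = 1 →
      u ∈ H₂)
    (hB₃ : ∀ h ∈ H₃, (h : Mat p 2) 0 1 = 0)
    (hU₃ : ∀ u : GLm p 2, (u : Mat p 2) 0 1 = 0 → (u : Mat p 2) 0 0 = 1 → (u : Mat p 2) 1 1 = 1 →
      u ∈ H₃)
    (htpp : SubgroupTPP H₁ H₂ H₃) :
    ¬ budget p 2 1 (2 + ε) <
      ((Nat.card H₁ * Nat.card H₂ * Nat.card H₃ : ℕ) : ℝ) ^ ((2 + ε) / 3) := by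
  have hV := decoratedSylow_volume_le hB₁ hU₁ hB₂ hU₂ hB₃ hU₃ htpp
  have h1 := rpow_volume_le_floor (p := p) hV (s := 2 + ε) (by linarith) (by linarith)
  have h2 := budget_two_ge (p := p) (2 + ε)
  exact not_lt.2 (h1.trans h2)

end DecoratedSylowNoGo

end Summit.MatrixMultiplication.MatrixMultiplication.Theorems.SubgroupIdentityDesigns.Negative
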